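import Literature.NumberTheory.Automorphic.CuspidalCohomologyGLShapiro
import Literature.NumberTheory.Automorphic.HeckeContractingElement
import Literature.Algebra.Homology.CoinducedConjugation
import HarnessLib

/-!
# Hecke operators of level-normalising elements restricted to an orbit are conjugation operators

Topic `NumberTheory/Automorphic`; namespace `Literature.NumberTheory.Automorphic.TwistedQuotient`.
A *proofs* file (theorems only), universe-polymorphic, for the twisted cohomology
`H^q(S_L, Ṽ) = H^q(Γ, Fun(𝒢 ⧸ L, V))` of `CuspidalCohomologyGL`.

Let `g ∈ 𝒢` normalise the level into itself, `g⁻¹ L g ⊆ L`, so that `T_g = [L g L]` is right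
translation `(T_g f)(xL) = f(x g L)` (`HeckeContractingElement`), and let `x₀ = x' L` be a point
whose right `g`-translate lies in its `Γ`-orbit through an element `t ∈ Γ`:

  `x' g L = ι(t) x' L`.                                                    (★)

Then (`HeckeOrbitConjugation`):

* `conj_mem_orbitStabilizer` — `t⁻¹ Γ_{x₀} t ⊆ Γ_{x₀}`;
* `orbitRestrict_heckeFun` — under restriction to the orbit of `x₀`,
  `Fun(𝒢 ⧸ L, V) → Coind_{Γ_{x₀}}^Γ V`, `f ↦ (γ ↦ ρ(γ) f(ι(γ)⁻¹ x₀))` (`CuspidalCohomologyGLShapiro`),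
  the Hecke operator `T_g` becomes the conjugation operator `(D_t F)(γ) = ρ(t) F(t⁻¹ γ)` of
  `Literature.Algebra.Homology.CoinducedConjugation`;
* `toOrbitCohomology_heckeEnd` — consequently, on cohomology, restriction-to-the-orbit followed by
  Shapiro's isomorphism `H^q(S_L, Ṽ) → H^q(Γ_{x₀}, V)` intertwines `T_g` with the pair map
  `Φ_t = H^q(c_t, ρ(t))`, `c_t(s) = t⁻¹ s t` (Mathlib's Shapiro isomorphism is restriction followed by
  evaluation, `Literature.Algebra.Homology.coindIso_hom_eq`, and `map_coindConj_comp_shapiroMap`).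

This is how the Hecke operators `T_{diag(1, x)}` at the good places act on the cohomology of the
Borel–Serre boundary strata `H^q(Γ_{x₀}, V)`, `Γ_{x₀} = Γ ∩ B`, through the algebraic torus
[Harder1987, §2, (2.3)–(2.5)].

## References

* G. Harder, *Eisenstein cohomology of arithmetic groups. The case GL₂*, Invent. Math. 89 (1987), §2.
  [Harder1987]
* K. S. Brown, *Cohomology of Groups*, GTM 87 (1982), III §5–§6, §8. [Brown1982CohomologyGroups]
-/

noncomputable section

open CategoryTheory Literature.Algebra.Homology

universe u

namespace Literature.NumberTheory.Automorphic.TwistedQuotient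

variable {k : Type u} [CommRing k] {Γ 𝒢 : Type u} [Group Γ] [Group 𝒢] (ι : Γ →* 𝒢) (L : Subgroup 𝒢)
  {V : Type u} [AddCommGroup V] [Module k V] (ρ : Representation k Γ V)
  {g : 𝒢} (hg : ∀ l ∈ L, g⁻¹ * l * g ∈ L) (x' : 𝒢) {t : Γ}
  (hx : ((x' * g : 𝒢) : 𝒢 ⧸ L) = ι t • ((x' : 𝒢) : 𝒢 ⧸ L))

/-! ### `T_g` is right translation -/

include hg in
/-- `(T_g f)(xL) = f(x g L)` for `g⁻¹ L g ⊆ L`. [cite: ShimuraIATAF1971, Ch. 3, §3.1] -/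
theorem heckeFun_apply_coe_of_conj'' (f : (𝒢 ⧸ L) → V) (x : 𝒢) :
    ArithmeticQuotient.heckeFun k L g V f (x : 𝒢 ⧸ L) = f ((x * g : 𝒢) : 𝒢 ⧸ L) := by
  classical
  have hfin := ArithmeticQuotient.finite_doubleCosetQuot_of_conj L hg
  have hset : hfin.toFinset = {(g : 𝒢 ⧸ L)} := by
    refine Finset.ext fun d => ?_
    rw [Set.Finite.mem_toFinset, Finset.mem_singleton]
    constructor
    · rintro ⟨l, rfl⟩
      change ((l : 𝒢) • (g : 𝒢 ⧸ L)) = _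
      rw [MulAction.Quotient.smul_coe, smul_eq_mul, QuotientGroup.eq]
      simpa [mul_assoc] using hg _ (L.inv_mem l.2)
    · rintro rfl
      exact MulAction.mem_orbit_self _
  rw [ArithmeticQuotient.heckeFun_apply_coe k L V g f x hfin, hset, Finset.sum_singleton,
    MulAction.Quotient.smul_coe, smul_eq_mul]

/-! ### The orbit condition `x' g L = ι(t) x' L` -/

include hx in
/-- `(y x') g L = y ι(t) x' L` for every `y`. [folklore] -/
theorem coe_mul_mul_eq (y : 𝒢) : ((y * x' * g : 𝒢) : 𝒢 ⧸ L) = ((y * ι t * x' : 𝒢) : 𝒢 ⧸ L) := by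
  have h1 : ((y * x' * g : 𝒢) : 𝒢 ⧸ L) = y • ((x' * g : 𝒢) : 𝒢 ⧸ L) := by
    rw [MulAction.Quotient.smul_coe, smul_eq_mul, mul_assoc]
  rw [h1, hx, MulAction.Quotient.smul_coe, MulAction.Quotient.smul_coe, smul_eq_mul, smul_eq_mul,
    mul_assoc]

include hg hx in
/-- **`t⁻¹ Γ_{x₀} t ⊆ Γ_{x₀}`** for `x₀ = x' L` with `x' g L = ι(t) x' L`. [cite: Harder1987, §2] -/
theorem conj_mem_orbitStabilizer (s : Γ) (hs : s ∈ orbitStabilizer ι L ((x' : 𝒢) : 𝒢 ⧸ L)) :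
    t⁻¹ * s * t ∈ orbitStabilizer ι L ((x' : 𝒢) : 𝒢 ⧸ L) := by
  change ι (t⁻¹ * s * t) • ((x' : 𝒢) : 𝒢 ⧸ L) = (x' : 𝒢 ⧸ L)
  have hs' : ι s • ((x' : 𝒢) : 𝒢 ⧸ L) = (x' : 𝒢 ⧸ L) := hs
  -- `ι(s) x' L = x' L`, hence `ι(s) x' g L = x' g L` (`g⁻¹ L g ⊆ L`)
  have h1 : ((ι s * x' : 𝒢) : 𝒢 ⧸ L) = (x' : 𝒢 ⧸ L) := by
    rwa [MulAction.Quotient.smul_coe, smul_eq_mul] at hs'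
  have h2 := ArithmeticQuotient.mk_mul_eq_mk_mul_of_conj L hg h1
  -- `ι(s) ι(t) x' L = ι(t) x' L`
  rw [coe_mul_mul_eq ι L x' hx, hx, MulAction.Quotient.smul_coe, smul_eq_mul] at h2
  rw [map_mul, map_mul, map_inv, mul_smul, mul_smul, MulAction.Quotient.smul_coe, smul_eq_mul,
    MulAction.Quotient.smul_coe, smul_eq_mul, ← mul_assoc, h2, inv_smul_eq_iff, MulAction.Quotient.smul_coe,
    smul_eq_mul]

/-! ### `T_g` restricted to the orbit is `D_t` -/

/-- The coefficient representation `V` of `Γ` in Mathlib's `Rep`. [folklore] -/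
abbrev coeffModuleRep : Rep k Γ := Rep.of ρ

include hg hx in
/-- **Restriction to the orbit turns `T_g` into the conjugation operator `D_t`**:
`orbitRestrict (T_g f) = D_t (orbitRestrict f)`, `(D_t F)(γ) = ρ(t) F(t⁻¹ γ)`. [cite: Harder1987, §2, (2.3)] -/
theorem orbitRestrict_heckeFun (f : (𝒢 ⧸ L) → V) :
    (orbitRestrict ι L ρ ((x' : 𝒢) : 𝒢 ⧸ L)).hom (ArithmeticQuotient.heckeFun k L g V f) =
      coindConjLinear (orbitStabilizer ι L ((x' : 𝒢) : 𝒢 ⧸ L)) (coeffModuleRep ρ) t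
        (conj_mem_orbitStabilizer ι L hg x' hx) ((orbitRestrict ι L ρ ((x' : 𝒢) : 𝒢 ⧸ L)).hom f) := by
  refine Subtype.ext (funext fun γ => ?_)
  rw [orbitRestrict_hom_apply_coe, coindConjLinear_apply_coe]
  change ρ γ (ArithmeticQuotient.heckeFun k L g V f ((ι γ)⁻¹ • ((x' : 𝒢) : 𝒢 ⧸ L))) =
    ρ t (ρ (t⁻¹ * γ) (f ((ι (t⁻¹ * γ))⁻¹ • ((x' : 𝒢) : 𝒢 ⧸ L))))
  rw [← Module.End.mul_apply, ← map_mul, mul_inv_cancel_left, MulAction.Quotient.smul_coe, smul_eq_mul,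
    heckeFun_apply_coe_of_conj'' L hg, coe_mul_mul_eq ι L x' hx, map_mul, map_inv, mul_inv_rev, inv_inv,
    MulAction.Quotient.smul_coe, smul_eq_mul]

include hg hx in
/-- The same as an identity of morphisms of representations:
`T_g ≫ orbitRestrict = orbitRestrict ≫ D_t`. [cite: Harder1987, §2, (2.3)] -/
theorem heckeRepHom_comp_orbitRestrict :
    heckeRepHom ι L ρ g ≫ orbitRestrict ι L ρ ((x' : 𝒢) : 𝒢 ⧸ L) =
      orbitRestrict ι L ρ ((x' : 𝒢) : 𝒢 ⧸ L) ≫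
        coindConj (orbitStabilizer ι L ((x' : 𝒢) : 𝒢 ⧸ L)) (coeffModuleRep ρ) t
          (conj_mem_orbitStabilizer ι L hg x' hx) := by
  refine Rep.hom_ext (Representation.IntertwiningMap.ext (LinearMap.ext fun f => ?_))
  exact orbitRestrict_heckeFun ι L ρ hg x' hx f

/-! ### On cohomology -/

include hg hx in
/-- **`T_g` on `H^q(S_L, Ṽ)` restricted to the orbit of `x₀` is the pair map `Φ_t = H^q(c_t, ρ(t))`
on `H^q(Γ_{x₀}, V)`**: `toOrbitCohomology (T_g y) = Φ_t (toOrbitCohomology y)`.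
[cite: Harder1987, §2, (2.3)–(2.5)] -/
theorem toOrbitCohomology_heckeEnd (q : ℕ) (y : cohomology ι L ρ q) :
    toOrbitCohomology ι L ρ ((x' : 𝒢) : 𝒢 ⧸ L) q (heckeEnd ι L ρ g q y) =
      (groupCohomology.map
          (subgroupConj (orbitStabilizer ι L ((x' : 𝒢) : 𝒢 ⧸ L)) t (conj_mem_orbitStabilizer ι L hg x' hx))
          (resConj (orbitStabilizer ι L ((x' : 𝒢) : 𝒢 ⧸ L)) (coeffModuleRep ρ) t
            (conj_mem_orbitStabilizer ι L hg x' hx)) q).hom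
        (toOrbitCohomology ι L ρ ((x' : 𝒢) : 𝒢 ⧸ L) q y) := by
  set S := orbitStabilizer ι L ((x' : 𝒢) : 𝒢 ⧸ L) with hS
  have ht := conj_mem_orbitStabilizer ι L hg x' hx
  -- `toOrbitCohomology = Ψ ∘ H^q(orbitRestrict)` with `Ψ` the explicit Shapiro map
  have hto : ∀ z : cohomology ι L ρ q, toOrbitCohomology ι L ρ ((x' : 𝒢) : 𝒢 ⧸ L) q z =
      (groupCohomology.map S.subtype (coindEv S (coeffModuleRep ρ)) q).hom
        ((groupCohomology.map (MonoidHom.id Γ) (orbitRestrict ι L ρ ((x' : 𝒢) : 𝒢 ⧸ L)) q).hom z) := by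
    intro z
    change ((groupCohomology.map (MonoidHom.id Γ) (orbitRestrict ι L ρ ((x' : 𝒢) : 𝒢 ⧸ L)) q) ≫
      (groupCohomology.coindIso (stabilizerRep ι L ρ ((x' : 𝒢) : 𝒢 ⧸ L)) q).hom) z = _
    rw [coindIso_hom_eq]
    rfl
  rw [hto, hto, ← shapiroMap_coindConj_apply S (coeffModuleRep ρ) t ht q]
  congr 1
  change ((groupCohomology.map (MonoidHom.id Γ) (heckeRepHom ι L ρ g) q) ≫
      groupCohomology.map (MonoidHom.id Γ) (orbitRestrict ι L ρ ((x' : 𝒢) : 𝒢 ⧸ L)) q) y =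
    ((groupCohomology.map (MonoidHom.id Γ) (orbitRestrict ι L ρ ((x' : 𝒢) : 𝒢 ⧸ L)) q) ≫
      groupCohomology.map (MonoidHom.id Γ) (coindConj S (coeffModuleRep ρ) t ht) q) y
  rw [← groupCohomology.map_id_comp, ← groupCohomology.map_id_comp,
    heckeRepHom_comp_orbitRestrict ι L ρ hg x' hx]

end Literature.NumberTheory.Automorphic.TwistedQuotient
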